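import Literature.MathematicalPhysics.QuantumManyBody.SwapPurity
import Mathlib.MeasureTheory.Integral.Prod

/-!
# Route `BECThomsonPrinciple`, crux `PeriodicToDirichlet` (stmt-AtomisticToContinuum-9483),
# line `entropy-swap`: registered stub `stub_occupationSqLeSwapPurity`

The operator-free Cauchy–Schwarz inequality `⟨φ, ρ₁ φ⟩² ≤ ‖φ‖⁴ tr ρ₁²` for the normalised
one-particle density matrix `ρ₁ = γ_Ψ/N` of an `N = n + 1`-body wave function `Ψ ∈ L²((ℝ³)^N)`,
in the tree's vocabulary: `occupation N φ Ψ ^ 2 ≤ N² · swapPurity n Ψ` for a sub-normalised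
measurable mode `φ` (`‖φ‖₂ ≤ 1`).

Proof (scalar Fubini, no operators). Write `Ψ_Y = Ψ(· :: Y)` (`Y ∈ (ℝ³)ⁿ`),
`a(Y) = ∫ conj φ(x) Ψ(x :: Y) dx`, `S = ∫ |a(Y)|² dY` (so `occupation = N · S`),
`G(x, x') = ∫ Ψ(x :: Y) conj Ψ(x' :: Y) dY` (the kernel of `ρ₁`) and
`K(Y, Y') = ∫ Ψ(x :: Y) conj Ψ(x :: Y') dx` (so `swapPurity = ∫∫ |K|²`). The one generic identity
`∫ |∫ F(a, b) db|² da = ∫∫ (∫ F(a, b) conj F(a, b') da) db db'` (expand the square as a product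
of two integrals and swap, Fubini; `osp_integral_sq_norm_integral`) gives both
`S = ∫∫ conj φ(x) φ(x') G(x, x') dx dx'` (with `F(Y, x) = conj φ(x) Ψ(x :: Y)`) and
`∫∫ |K|² = ∫∫ |G|²` (with `F((Y, Y'), x) = Ψ(x :: Y) conj Ψ(x :: Y')`), whence by Cauchy–Schwarz
on `ℝ³ × ℝ³`: `S² ≤ ‖φ ⊗ conj φ‖₂² ‖G‖₂² = ‖φ‖₂⁴ · swapPurity ≤ swapPurity`. The integrability
needed for the two Fubini swaps is `∫ (∫ |φ| |Ψ_Y|)² dY ≤ ‖φ‖₂² ‖Ψ‖₂² < ∞` and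
`∫∫ (∫ |Ψ_Y| |Ψ_Y'|)² ≤ ‖Ψ‖₂⁴ < ∞` (Cauchy–Schwarz in `ℝ≥0∞`, Tonelli).

References: Penrose–Onsager 1956 §4 (5)–(6) (`∑ nₐ² = N² A₂`, the purity functional) — used
only through the tree's `swapPurity`; everything here is [folklore].
-/

noncomputable section

namespace Summit.AtomisticToContinuum.BoseEinsteinCondensation.EntropySwap

open Literature.MathematicalPhysics.QuantumManyBody.BoseGas
open MeasureTheory
open scoped ENNReal NNReal ComplexConjugate

/-! ### Two generic scalar lemmas -/

/-- `∫ |g|² = |∫ (|g| : ℂ)²|` in `ℝ≥0∞`, for `g ∈ L²`: the bridge between the `lintegral` of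
`‖g‖₊²` and the complex Bochner integral of `(‖g‖ : ℂ)²`. [folklore] -/
theorem osp_lintegral_sq_eq_nnnorm_integral {α : Type*} [MeasurableSpace α] {μ : Measure α}
    {g : α → ℂ} (hg : AEStronglyMeasurable g μ) (hfin : ∫⁻ a, (‖g a‖₊ : ℝ≥0∞) ^ 2 ∂μ ≠ ⊤) :
    ∫⁻ a, (‖g a‖₊ : ℝ≥0∞) ^ 2 ∂μ = ‖∫ a, ((‖g a‖ : ℂ)) ^ 2 ∂μ‖₊ := by
  have h1 : ∫ a, ‖g a‖ ^ 2 ∂μ = (∫⁻ a, (‖g a‖₊ : ℝ≥0∞) ^ 2 ∂μ).toReal := by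
    rw [integral_eq_lintegral_of_nonneg_ae (f := fun a => ‖g a‖ ^ 2)
      (Filter.Eventually.of_forall fun a => sq_nonneg _)
      (hg.norm.aemeasurable.pow_const 2).aestronglyMeasurable]
    congr 1
    refine lintegral_congr fun a => ?_
    rw [ENNReal.ofReal_pow (norm_nonneg _), ofReal_norm, enorm_eq_nnnorm]
  have h2 : ∫ a, ((‖g a‖ : ℂ)) ^ 2 ∂μ = ((∫ a, ‖g a‖ ^ 2 ∂μ : ℝ) : ℂ) := by
    rw [← integral_complex_ofReal]
    simp only [Complex.ofReal_pow]
  rw [h2, Complex.nnnorm_real, h1, ← enorm_eq_nnnorm, Real.enorm_eq_ofReal ENNReal.toReal_nonneg,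
    ENNReal.ofReal_toReal hfin]

/-- **Squared norm of a parametric integral as a double integral**: for a jointly measurable
`F : α × β → ℂ` with `∫ (∫ |F(a, b)| db)² da < ∞`,
`∫ |∫ F(a, b) db|² da = ∫∫ (∫ F(a, b) conj F(a, b') da) d(b, b')`: expand
`|∫ F(a, ·)|² = (∫ F(a, b) db)(∫ conj F(a, b') db') = ∫∫ F(a, b) conj F(a, b')` and swap the `a`-
and `(b, b')`-integrals (Fubini; the hypothesis is exactly the integrability of the triple
integrand). [folklore] -/
theorem osp_integral_sq_norm_integral {α β : Type*} [MeasurableSpace α] [MeasurableSpace β]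
    {μ : Measure α} {ν : Measure β} [SFinite μ] [SFinite ν] {F : α → β → ℂ}
    (hF : Measurable (Function.uncurry F))
    (hfin : ∫⁻ a, (∫⁻ b, (‖F a b‖₊ : ℝ≥0∞) ∂ν) ^ 2 ∂μ ≠ ⊤) :
    ∫ a, ((‖∫ b, F a b ∂ν‖ : ℂ)) ^ 2 ∂μ =
      ∫ q : β × β, ∫ a, F a q.1 * conj (F a q.2) ∂μ ∂(ν.prod ν) := by
  have hFa : ∀ a, Measurable (F a) := fun a => hF.of_uncurry_left
  -- the triple integrand is measurable and integrable
  have hH : Measurable fun z : α × (β × β) => F z.1 z.2.1 * conj (F z.1 z.2.2) := by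
    have h1 : Measurable fun z : α × (β × β) => F z.1 z.2.1 :=
      hF.comp (measurable_fst.prodMk (measurable_fst.comp measurable_snd))
    have h2 : Measurable fun z : α × (β × β) => F z.1 z.2.2 :=
      hF.comp (measurable_fst.prodMk (measurable_snd.comp measurable_snd))
    exact h1.mul (Complex.continuous_conj.measurable.comp h2)
  have hint : Integrable (fun z : α × (β × β) => F z.1 z.2.1 * conj (F z.1 z.2.2))
      (μ.prod (ν.prod ν)) := by
    refine ⟨hH.aestronglyMeasurable, ?_⟩
    rw [hasFiniteIntegral_iff_enorm]
    calc ∫⁻ z, ‖F z.1 z.2.1 * conj (F z.1 z.2.2)‖ₑ ∂μ.prod (ν.prod ν)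
        = ∫⁻ a, ∫⁻ q, (‖F a q.1‖₊ : ℝ≥0∞) * ‖F a q.2‖₊ ∂ν.prod ν ∂μ := by
          rw [lintegral_prod _ hH.enorm.aemeasurable]
          refine lintegral_congr fun a => lintegral_congr fun q => ?_
          simp only [enorm_eq_nnnorm, nnnorm_mul, ENNReal.coe_mul, RCLike.nnnorm_conj]
      _ = ∫⁻ a, (∫⁻ b, (‖F a b‖₊ : ℝ≥0∞) ∂ν) * ∫⁻ b, (‖F a b‖₊ : ℝ≥0∞) ∂ν ∂μ := by
          refine lintegral_congr fun a => ?_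
          exact lintegral_prod_mul (hFa a).nnnorm.coe_nnreal_ennreal.aemeasurable
            (hFa a).nnnorm.coe_nnreal_ennreal.aemeasurable
      _ = ∫⁻ a, (∫⁻ b, (‖F a b‖₊ : ℝ≥0∞) ∂ν) ^ 2 ∂μ := by simp_rw [sq]
      _ < ⊤ := hfin.lt_top
  -- pointwise expansion of the square, then Fubini
  have hpt : ∀ a, ((‖∫ b, F a b ∂ν‖ : ℂ)) ^ 2 =
      ∫ q : β × β, F a q.1 * conj (F a q.2) ∂(ν.prod ν) := by
    intro a
    rw [← Complex.mul_conj', ← integral_conj, ← integral_prod_mul]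
  simp_rw [hpt]
  exact integral_integral_swap (f := fun a (q : β × β) => F a q.1 * conj (F a q.2)) hint

/-! ### Slices `Ψ_Y = Ψ(· :: Y)` and the kernel `G(x, x') = ∫ Ψ(x :: Y) conj Ψ(x' :: Y) dY` -/

variable {n : ℕ}

/-- **Tonelli, first coordinate outermost**: `∫ (∫ F(x :: Y) dY) dx = ∫ F(Z) dZ` for measurable
`F ≥ 0` on `(ℝ³)^{n+1}`. [folklore] -/
theorem osp_lintegral_lintegral_vecCons {F : Config (n + 1) → ℝ≥0∞} (hF : Measurable F) :
    ∫⁻ x : Space, ∫⁻ Y : Config n, F (Matrix.vecCons x Y) = ∫⁻ Z, F Z := by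
  rw [← measurePreserving_vecCons.lintegral_comp hF,
    lintegral_prod (fun p : Space × Config n => F (Matrix.vecCons p.1 p.2))
      (hF.comp measurable_vecCons).aemeasurable]

/-- The kernel `(x, x') ↦ G(x, x') = ∫ Ψ(x :: Y) conj Ψ(x' :: Y) dY` of `γ_Ψ/N` is (jointly)
measurable. [folklore] -/
theorem osp_measurable_kernel {Ψ : Config (n + 1) → ℂ} (hΨ : Measurable Ψ) :
    Measurable fun q : Space × Space =>
      ∫ Y : Config n, Ψ (Matrix.vecCons q.1 Y) * conj (Ψ (Matrix.vecCons q.2 Y)) := by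
  have h : Measurable fun r : (Space × Space) × Config n =>
      Ψ (Matrix.vecCons r.1.1 r.2) * conj (Ψ (Matrix.vecCons r.1.2 r.2)) := by
    have h1 : Measurable fun r : (Space × Space) × Config n => Ψ (Matrix.vecCons r.1.1 r.2) :=
      hΨ.comp (measurable_vecCons.comp ((measurable_fst.comp measurable_fst).prodMk measurable_snd))
    have h2 : Measurable fun r : (Space × Space) × Config n => Ψ (Matrix.vecCons r.1.2 r.2) :=
      hΨ.comp (measurable_vecCons.comp ((measurable_snd.comp measurable_fst).prodMk measurable_snd))
    exact h1.mul (Complex.continuous_conj.measurable.comp h2)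
  exact (h.stronglyMeasurable.integral_prod_right' (ν := (volume : Measure (Config n)))).measurable

/-- `∫∫ |G(x, x')|² dx dx' ≤ ‖Ψ‖₂⁴`: Cauchy–Schwarz `|G(x, x')|² ≤ ρ(x) ρ(x')` with the density
`ρ(x) = ∫ |Ψ(x :: Y)|² dY`, `∫ ρ = ‖Ψ‖₂²` (Tonelli). [folklore] -/
theorem osp_lintegral_sq_kernel_le {Ψ : Config (n + 1) → ℂ} (hΨ : Measurable Ψ) :
    ∫⁻ q : Space × Space, (‖∫ Y : Config n, Ψ (Matrix.vecCons q.1 Y) *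
        conj (Ψ (Matrix.vecCons q.2 Y))‖₊ : ℝ≥0∞) ^ 2 ≤ (∫⁻ Z, (‖Ψ Z‖₊ : ℝ≥0∞) ^ 2) ^ 2 := by
  set ρ : Space → ℝ≥0∞ := fun x => ∫⁻ Y : Config n, (‖Ψ (Matrix.vecCons x Y)‖₊ : ℝ≥0∞) ^ 2
    with hρ
  have hcol : ∀ x : Space, Measurable fun Y : Config n => Ψ (Matrix.vecCons x Y) := fun x =>
    hΨ.comp (measurable_vecCons.comp (measurable_const.prodMk measurable_id))
  have hρm : Measurable ρ :=
    ((hΨ.comp measurable_vecCons).nnnorm.coe_nnreal_ennreal.pow_const 2).lintegral_prod_right'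
  have hρi : ∫⁻ x, ρ x = ∫⁻ Z, (‖Ψ Z‖₊ : ℝ≥0∞) ^ 2 :=
    osp_lintegral_lintegral_vecCons (hΨ.nnnorm.coe_nnreal_ennreal.pow_const 2)
  calc _ ≤ ∫⁻ q : Space × Space, ρ q.1 * ρ q.2 :=
        lintegral_mono fun q => sq_nnnorm_integral_mul_conj_le (hcol q.1).aemeasurable
          (hcol q.2).aemeasurable
    _ = (∫⁻ x, ρ x) * ∫⁻ x, ρ x := by
        rw [Measure.volume_eq_prod, lintegral_prod_mul hρm.aemeasurable hρm.aemeasurable]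
    _ = (∫⁻ Z, (‖Ψ Z‖₊ : ℝ≥0∞) ^ 2) ^ 2 := by rw [hρi, sq]

/-- **`∫∫ |G(x, x')|² dx dx' = swapPurity n Ψ = ∫∫ |K(Y, Y')|² dY dY'`** (`tr γ² ` computed from
either kernel) for measurable `Ψ ∈ L²`: both sides equal the quadruple integral
`∫∫∫∫ Ψ(x::Y) conj Ψ(x::Y') conj Ψ(x'::Y) Ψ(x'::Y')` (Fubini, `osp_integral_sq_norm_integral`
with `F((Y, Y'), x) = Ψ(x :: Y) conj Ψ(x :: Y')`). [folklore] -/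
theorem osp_lintegral_sq_kernel_eq_swapPurity {Ψ : Config (n + 1) → ℂ} (hΨ : Measurable Ψ)
    (hfin : ∫⁻ Z, (‖Ψ Z‖₊ : ℝ≥0∞) ^ 2 ≠ ⊤) :
    ∫⁻ q : Space × Space, (‖∫ Y : Config n, Ψ (Matrix.vecCons q.1 Y) *
        conj (Ψ (Matrix.vecCons q.2 Y))‖₊ : ℝ≥0∞) ^ 2 = swapPurity n Ψ := by
  have h4 : (∫⁻ Z, (‖Ψ Z‖₊ : ℝ≥0∞) ^ 2) ^ 2 ≠ ⊤ := ENNReal.pow_ne_top hfin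
  have hslice : ∀ Y : Config n, Measurable fun x : Space => Ψ (Matrix.vecCons x Y) :=
    measurable_comp_vecCons_left hΨ
  set w : Config n → ℝ≥0∞ := fun Y => ∫⁻ x : Space, (‖Ψ (Matrix.vecCons x Y)‖₊ : ℝ≥0∞) ^ 2
    with hw
  have hwm : Measurable w := measurable_lintegral_sq_nnnorm_vecCons hΨ
  have hwi : ∫⁻ Y, w Y = ∫⁻ Z, (‖Ψ Z‖₊ : ℝ≥0∞) ^ 2 := lintegral_lintegral_sq_nnnorm_vecCons hΨ
  -- the integrand `F((Y, Y'), x) = Ψ(x :: Y) conj Ψ(x :: Y')` of the swap kernel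
  have hFm : Measurable fun p : (Config n × Config n) × Space =>
      Ψ (Matrix.vecCons p.2 p.1.1) * conj (Ψ (Matrix.vecCons p.2 p.1.2)) := by
    have h1 : Measurable fun p : (Config n × Config n) × Space => Ψ (Matrix.vecCons p.2 p.1.1) :=
      hΨ.comp (measurable_vecCons.comp (measurable_snd.prodMk (measurable_fst.comp measurable_fst)))
    have h2 : Measurable fun p : (Config n × Config n) × Space => Ψ (Matrix.vecCons p.2 p.1.2) :=
      hΨ.comp (measurable_vecCons.comp (measurable_snd.prodMk (measurable_snd.comp measurable_fst)))
    exact h1.mul (Complex.continuous_conj.measurable.comp h2)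
  have hAfin : ∫⁻ P : Config n × Config n, (∫⁻ x, (‖Ψ (Matrix.vecCons x P.1) *
      conj (Ψ (Matrix.vecCons x P.2))‖₊ : ℝ≥0∞)) ^ 2 ≠ ⊤ := by
    refine ne_top_of_le_ne_top h4 ?_
    calc _ ≤ ∫⁻ P : Config n × Config n, w P.1 * w P.2 := by
          refine lintegral_mono fun P => ?_
          have h : ∀ x, (‖Ψ (Matrix.vecCons x P.1) * conj (Ψ (Matrix.vecCons x P.2))‖₊ : ℝ≥0∞) =
              ‖Ψ (Matrix.vecCons x P.1)‖₊ * ‖Ψ (Matrix.vecCons x P.2)‖₊ := fun x => by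
            rw [nnnorm_mul, ENNReal.coe_mul, RCLike.nnnorm_conj]
          simp_rw [h]
          exact lintegral_mul_sq_le volume (hslice P.1).nnnorm.coe_nnreal_ennreal.aemeasurable
            (hslice P.2).nnnorm.coe_nnreal_ennreal.aemeasurable
      _ = (∫⁻ Y, w Y) * ∫⁻ Y, w Y := by
          rw [Measure.volume_eq_prod, lintegral_prod_mul hwm.aemeasurable hwm.aemeasurable]
      _ = _ := by rw [hwi, sq]
  -- (a local copy keeps the instance term for the product `Config n × Config n` small)
  haveI : SFinite (volume : Measure (Config n)) := inferInstance
  rw [osp_lintegral_sq_eq_nnnorm_integral (osp_measurable_kernel hΨ).aestronglyMeasurable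
      (ne_top_of_le_ne_top h4 (osp_lintegral_sq_kernel_le hΨ)), swapPurity,
    osp_lintegral_sq_eq_nnnorm_integral (measurable_swapKernel hΨ).aestronglyMeasurable
      (ne_top_of_le_ne_top h4 (swapPurity_le_lintegral_sq hΨ)),
    osp_integral_sq_norm_integral (F := fun (P : Config n × Config n) (x : Space) =>
      Ψ (Matrix.vecCons x P.1) * conj (Ψ (Matrix.vecCons x P.2))) hFm hAfin,
    ← Measure.volume_eq_prod]
  congr 2
  refine integral_congr_ae (Filter.Eventually.of_forall fun q => ?_)
  have hpt : ∀ P : Config n × Config n,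
      Ψ (Matrix.vecCons q.1 P.1) * conj (Ψ (Matrix.vecCons q.1 P.2)) *
          conj (Ψ (Matrix.vecCons q.2 P.1) * conj (Ψ (Matrix.vecCons q.2 P.2))) =
        Ψ (Matrix.vecCons q.1 P.1) * conj (Ψ (Matrix.vecCons q.2 P.1)) *
          conj (Ψ (Matrix.vecCons q.1 P.2) * conj (Ψ (Matrix.vecCons q.2 P.2))) := fun P => by
    simp only [map_mul, Complex.conj_conj]; ring
  simp_rw [hpt]
  rw [← Complex.mul_conj', ← integral_conj, ← integral_prod_mul, Measure.volume_eq_prod]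

/-! ### The Cauchy–Schwarz step -/

/-- **`S² ≤ ∫∫|G|² · ‖φ‖₂⁴`** for `S = ∫ |⟨φ, Ψ_Y⟩|² dY`: `S = ∫∫ conj φ(x) φ(x') G(x, x')`
(Fubini, `osp_integral_sq_norm_integral` with `F(Y, x) = conj φ(x) Ψ(x :: Y)`), then
Cauchy–Schwarz on `ℝ³ × ℝ³`. [folklore] -/
theorem osp_sliceOverlap_sq_le {φ : Space → ℂ} {Ψ : Config (n + 1) → ℂ} (hφ : Measurable φ)
    (hΨ : Measurable Ψ) (hφ2 : ∫⁻ x, (‖φ x‖₊ : ℝ≥0∞) ^ 2 ≠ ⊤)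
    (hfin : ∫⁻ Z, (‖Ψ Z‖₊ : ℝ≥0∞) ^ 2 ≠ ⊤) :
    (∫⁻ Y : Config n, (‖∫ x, conj (φ x) * Ψ (Matrix.vecCons x Y)‖₊ : ℝ≥0∞) ^ 2) ^ 2 ≤
      (∫⁻ q : Space × Space, (‖∫ Y : Config n, Ψ (Matrix.vecCons q.1 Y) *
        conj (Ψ (Matrix.vecCons q.2 Y))‖₊ : ℝ≥0∞) ^ 2) * (∫⁻ x, (‖φ x‖₊ : ℝ≥0∞) ^ 2) ^ 2 := by
  have hslice : ∀ Y : Config n, Measurable fun x : Space => Ψ (Matrix.vecCons x Y) :=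
    measurable_comp_vecCons_left hΨ
  -- the integrand `F(Y, x) = conj φ(x) Ψ(x :: Y)`
  have hFm : Measurable fun p : Config n × Space => conj (φ p.2) * Ψ (Matrix.vecCons p.2 p.1) :=
    (Complex.continuous_conj.measurable.comp (hφ.comp measurable_snd)).mul
      (hΨ.comp (measurable_vecCons.comp (measurable_snd.prodMk measurable_fst)))
  have ham : Measurable fun Y : Config n => ∫ x, conj (φ x) * Ψ (Matrix.vecCons x Y) :=
    (hFm.stronglyMeasurable.integral_prod_right' (ν := (volume : Measure Space))).measurable
  have hnn : ∀ (Y : Config n) (x : Space),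
      (‖conj (φ x) * Ψ (Matrix.vecCons x Y)‖₊ : ℝ≥0∞) = ‖φ x‖₊ * ‖Ψ (Matrix.vecCons x Y)‖₊ :=
    fun Y x => by rw [nnnorm_mul, ENNReal.coe_mul, RCLike.nnnorm_conj]
  -- `∫ (∫ |φ| |Ψ_Y|)² dY ≤ ‖φ‖² ‖Ψ‖² < ∞`
  have hAfin : ∫⁻ Y : Config n,
      (∫⁻ x, (‖conj (φ x) * Ψ (Matrix.vecCons x Y)‖₊ : ℝ≥0∞)) ^ 2 ≠ ⊤ := by
    refine ne_top_of_le_ne_top (ENNReal.mul_ne_top hφ2 hfin) ?_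
    calc _ ≤ ∫⁻ Y : Config n, (∫⁻ x, (‖φ x‖₊ : ℝ≥0∞) ^ 2) *
            ∫⁻ x, (‖Ψ (Matrix.vecCons x Y)‖₊ : ℝ≥0∞) ^ 2 := by
          refine lintegral_mono fun Y => ?_
          simp_rw [hnn]
          exact lintegral_mul_sq_le volume hφ.nnnorm.coe_nnreal_ennreal.aemeasurable
            (hslice Y).nnnorm.coe_nnreal_ennreal.aemeasurable
      _ = _ := by
          rw [lintegral_const_mul _ (measurable_lintegral_sq_nnnorm_vecCons hΨ),
            lintegral_lintegral_sq_nnnorm_vecCons hΨ]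
  -- `S < ∞`
  have hS : ∫⁻ Y : Config n, (‖∫ x, conj (φ x) * Ψ (Matrix.vecCons x Y)‖₊ : ℝ≥0∞) ^ 2 ≠ ⊤ := by
    refine ne_top_of_le_ne_top hAfin (lintegral_mono fun Y => ?_)
    gcongr
    exact enorm_integral_le_lintegral_enorm _
  -- the mode tensor `φ ⊗ conj φ`
  have hgm : Measurable fun q : Space × Space => φ q.1 * conj (φ q.2) :=
    (hφ.comp measurable_fst).mul (Complex.continuous_conj.measurable.comp (hφ.comp measurable_snd))
  have hgg : ∫⁻ q : Space × Space, (‖φ q.1 * conj (φ q.2)‖₊ : ℝ≥0∞) ^ 2 =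
      (∫⁻ x, (‖φ x‖₊ : ℝ≥0∞) ^ 2) ^ 2 := by
    have h : ∀ q : Space × Space, (‖φ q.1 * conj (φ q.2)‖₊ : ℝ≥0∞) ^ 2 =
        (‖φ q.1‖₊ : ℝ≥0∞) ^ 2 * (‖φ q.2‖₊ : ℝ≥0∞) ^ 2 := fun q => by
      rw [nnnorm_mul, ENNReal.coe_mul, RCLike.nnnorm_conj, mul_pow]
    simp_rw [h]
    rw [Measure.volume_eq_prod, lintegral_prod_mul
      (hφ.nnnorm.coe_nnreal_ennreal.pow_const 2).aemeasurable
      (hφ.nnnorm.coe_nnreal_ennreal.pow_const 2).aemeasurable, sq]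
  -- `S = |∫∫ G · conj(φ ⊗ conj φ)|`
  have hinner : ∀ q : Space × Space,
      ∫ Y : Config n, conj (φ q.1) * Ψ (Matrix.vecCons q.1 Y) *
          conj (conj (φ q.2) * Ψ (Matrix.vecCons q.2 Y)) =
        (∫ Y : Config n, Ψ (Matrix.vecCons q.1 Y) * conj (Ψ (Matrix.vecCons q.2 Y))) *
          conj (φ q.1 * conj (φ q.2)) := by
    intro q
    rw [← integral_mul_const]
    refine integral_congr_ae (Filter.Eventually.of_forall fun Y => ?_)
    simp only [map_mul, Complex.conj_conj]; ring
  rw [osp_lintegral_sq_eq_nnnorm_integral ham.aestronglyMeasurable hS,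
    osp_integral_sq_norm_integral
      (F := fun (Y : Config n) (x : Space) => conj (φ x) * Ψ (Matrix.vecCons x Y)) hFm hAfin]
  simp_rw [hinner]
  rw [← Measure.volume_eq_prod, ← hgg]
  exact sq_nnnorm_integral_mul_conj_le (osp_measurable_kernel hΨ).aemeasurable hgm.aemeasurable

/-! ### The registered stub -/

/-- **Stub `stub_occupationSqLeSwapPurity`** of line `entropy-swap` (crux `PeriodicToDirichlet`):
the operator-free Cauchy–Schwarz `⟨φ, ρ₁ φ⟩² ≤ tr ρ₁²`, i.e.
`occupation N φ Ψ ^ 2 ≤ N² · swapPurity n Ψ` (`N = n + 1`) for a measurable sub-normalised mode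
`φ` and a measurable `Ψ ∈ L²`. [folklore] -/
theorem stub_occupationSqLeSwapPurity :
    ∀ (n : ℕ) (φ : Space → ℂ) (Ψ : Config (n + 1) → ℂ), Measurable φ → Measurable Ψ →
      (∫⁻ x, (‖φ x‖₊ : ℝ≥0∞) ^ 2) ≤ 1 → (∫⁻ X, (‖Ψ X‖₊ : ℝ≥0∞) ^ 2) ≠ ⊤ →
        occupation (n + 1) φ Ψ ^ 2 ≤ ((n + 1 : ℕ) : ℝ≥0∞) ^ 2 * swapPurity n Ψ := by
  intro n φ Ψ hφ hΨ hφ1 hΨfin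
  have hφ2 : ∫⁻ x, (‖φ x‖₊ : ℝ≥0∞) ^ 2 ≠ ⊤ := ne_top_of_le_ne_top ENNReal.one_ne_top hφ1
  have key := osp_sliceOverlap_sq_le (n := n) hφ hΨ hφ2 hΨfin
  rw [osp_lintegral_sq_kernel_eq_swapPurity hΨ hΨfin] at key
  have key' : (∫⁻ Y : Config n,
      (‖∫ x, conj (φ x) * Ψ (Matrix.vecCons x Y)‖₊ : ℝ≥0∞) ^ 2) ^ 2 ≤ swapPurity n Ψ := by
    calc _ ≤ _ := key
      _ ≤ swapPurity n Ψ * 1 ^ 2 := by gcongr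
      _ = swapPurity n Ψ := by rw [one_pow, mul_one]
  have hocc : occupation (n + 1) φ Ψ = ((n + 1 : ℕ) : ℝ≥0∞) *
      ∫⁻ Y : Config n, (‖∫ x, conj (φ x) * Ψ (Matrix.vecCons x Y)‖₊ : ℝ≥0∞) ^ 2 := by
    push_cast
    rfl
  rw [hocc, mul_pow]
  gcongr

end Summit.AtomisticToContinuum.BoseEinsteinCondensation.EntropySwap
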